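import Literature.Analysis.DeBrangesSpaces.Basic
import Summits.RiemannHypothesis.RiemannHypothesis.Theorems.SpectralTraceWindowTraceArchStubStructureFunctionAux
import HarnessLib

/-!
# The structure function of a configuration — auxiliary file 2: the Hermite–Biehler property

Helper file for the stub `stub_structureFunction` of the line `causal-level-sets` for the crux
`WindowTraceArch` (stmt-RiemannHypothesis-11195; skeleton
`Summit.RiemannHypothesis.RiemannHypothesis.Cruxes.WindowTraceArch.CausalLevelSets`; the stub is
proved in `Theorems/SpectralTraceWindowTraceArchStubStructureFunction.lean`).

Continuation of `…StubStructureFunctionAux.lean` (no new definitions). For zeros `w_k` with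
`δ ≤ -Im w_k ≤ B` (`δ > 0`) and `Σ_k 1/(1 + (Re w_k)²) < ∞`, the canonical product
`E(z) = ∏_k (1 - z/w_k) e^{Re(1/w_k) z}` satisfies:

* `structFn_isHermiteBiehler` : `E` is a Hermite–Biehler function — each factor has modulus
  `|w_k - z|/|w_k| · e^{Re(1/w_k) Re z}`, symmetric under `z ↦ z̄` except for `|w_k - z|`, and
  `|w_k - z̄| < |w_k - z|` for `Im z > 0` (the zeros lie in the lower half-plane); the strict
  inequality survives the limit through the first factor;
* `structFn_norm_logDeriv_le` : on `Im z ≥ -δ/2`,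
  `‖E'(z)/E(z)‖ ≤ (1 + 2/δ + B)(1 + δ⁻²)(Σ_k 1/(1 + (Re w_k)²)) (1 + |z|)²` (termwise:
  `|z - w_k| ≥ δ/2` gives `1/(|z - w_k||w_k|) ≤ (1 + 2|z|/δ)/|w_k|²`);
* `structFn_exists` (registered sub-goal) : the package — a Hermite–Biehler `E`, zero-free on
  `Im z > -δ`, with `E'/E = Σ_k (1/(z - w_k) + Re(1/w_k))` there and the growth bound above.

**Sources.** L. de Branges, *Hilbert Spaces of Entire Functions* (1968), §7 (products over zeros in
the lower half-plane are of Hermite–Biehler class); B. Ya. Levin, *Lectures on Entire Functions*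
(1996), Lecture 27. All statements are proved here from Mathlib.
-/

set_option linter.dupNamespace false

noncomputable section

open Complex Set Filter Metric
open scoped Real Topology ComplexConjugate

namespace Summit.RiemannHypothesis.RiemannHypothesis.Theorems.SpectralTraceWindowTraceArch

open Literature.Analysis.DeBrangesSpaces (IsHermiteBiehler)

/-! ### Moduli of the factors -/

/-- `‖(1 - z/w) e^{Re(1/w) z}‖ = |w - z|/|w| · e^{Re(1/w) Re z}`. -/
theorem structFn_norm_factor {w : ℂ} (hw0 : w ≠ 0) (z : ℂ) :
    ‖(1 - z / w) * cexp ((((w⁻¹).re : ℝ) : ℂ) * z)‖ =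
      ‖w - z‖ / ‖w‖ * Real.exp ((w⁻¹).re * z.re) := by
  rw [norm_mul, Complex.norm_exp, one_sub_div hw0, norm_div, Complex.re_ofReal_mul]

/-- For `Im w < 0 < Im z`: `|w - z̄| < |w - z|`. -/
theorem structFn_norm_sub_conj_lt {w z : ℂ} (hw : w.im < 0) (hz : 0 < z.im) :
    ‖w - conj z‖ < ‖w - z‖ := by
  have h : ‖w - conj z‖ ^ 2 < ‖w - z‖ ^ 2 := by
    rw [Complex.sq_norm, Complex.sq_norm, Complex.normSq_apply, Complex.normSq_apply]
    simp only [Complex.sub_re, Complex.sub_im, Complex.conj_re, Complex.conj_im]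
    nlinarith [mul_neg_of_neg_of_pos hw hz]
  exact lt_of_pow_lt_pow_left₀ 2 (norm_nonneg _) h

/-- Each factor is larger at `z` than at `z̄` (`Im z > 0`, zero `w` in the lower half-plane). -/
theorem structFn_norm_factor_conj_le {w z : ℂ} (hw : w.im < 0) (hz : 0 < z.im) :
    ‖(1 - conj z / w) * cexp ((((w⁻¹).re : ℝ) : ℂ) * conj z)‖ ≤
      ‖(1 - z / w) * cexp ((((w⁻¹).re : ℝ) : ℂ) * z)‖ := by
  have hw0 : w ≠ 0 := by
    rintro rfl
    simp at hw
  rw [structFn_norm_factor hw0, structFn_norm_factor hw0, Complex.conj_re]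
  gcongr
  exact (structFn_norm_sub_conj_lt hw hz).le

/-- The exchange identity for one factor:
`|w - z̄| · ‖factor(z)‖ = |w - z| · ‖factor(z̄)‖`. -/
theorem structFn_norm_factor_conj_mul {w : ℂ} (hw0 : w ≠ 0) (z : ℂ) :
    ‖w - conj z‖ * ‖(1 - z / w) * cexp ((((w⁻¹).re : ℝ) : ℂ) * z)‖ =
      ‖w - z‖ * ‖(1 - conj z / w) * cexp ((((w⁻¹).re : ℝ) : ℂ) * conj z)‖ := by
  rw [structFn_norm_factor hw0, structFn_norm_factor hw0, Complex.conj_re]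
  ring

/-- The partial products with at least one factor:
`|w₀ - z| · |P_{N+1}(z̄)| ≤ |w₀ - z̄| · |P_{N+1}(z)|` for `Im z > 0`. -/
theorem structFn_prod_conj_le {w : ℕ → ℂ} (hw : ∀ k, (w k).im < 0) {z : ℂ} (hz : 0 < z.im)
    (N : ℕ) :
    ‖w 0 - z‖ * ‖∏ k ∈ Finset.range (N + 1),
        (1 - conj z / w k) * cexp (((((w k)⁻¹).re : ℝ) : ℂ) * conj z)‖ ≤
      ‖w 0 - conj z‖ * ‖∏ k ∈ Finset.range (N + 1),
        (1 - z / w k) * cexp (((((w k)⁻¹).re : ℝ) : ℂ) * z)‖ := by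
  have hw0 : w 0 ≠ 0 := by
    intro h
    have := hw 0
    rw [h] at this
    simp at this
  rw [norm_prod, norm_prod, Finset.prod_range_succ', Finset.prod_range_succ']
  calc ‖w 0 - z‖ * ((∏ k ∈ Finset.range N,
        ‖(1 - conj z / w (k + 1)) * cexp (((((w (k + 1))⁻¹).re : ℝ) : ℂ) * conj z)‖) *
          ‖(1 - conj z / w 0) * cexp (((((w 0)⁻¹).re : ℝ) : ℂ) * conj z)‖)
      = (∏ k ∈ Finset.range N,
          ‖(1 - conj z / w (k + 1)) * cexp (((((w (k + 1))⁻¹).re : ℝ) : ℂ) * conj z)‖) *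
          (‖w 0 - conj z‖ * ‖(1 - z / w 0) * cexp (((((w 0)⁻¹).re : ℝ) : ℂ) * z)‖) := by
        rw [structFn_norm_factor_conj_mul hw0]
        ring
    _ ≤ (∏ k ∈ Finset.range N,
          ‖(1 - z / w (k + 1)) * cexp (((((w (k + 1))⁻¹).re : ℝ) : ℂ) * z)‖) *
          (‖w 0 - conj z‖ * ‖(1 - z / w 0) * cexp (((((w 0)⁻¹).re : ℝ) : ℂ) * z)‖) := by
        gcongr with k _
        exact structFn_norm_factor_conj_le (hw (k + 1)) hz
    _ = ‖w 0 - conj z‖ * ((∏ k ∈ Finset.range N,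
          ‖(1 - z / w (k + 1)) * cexp (((((w (k + 1))⁻¹).re : ℝ) : ℂ) * z)‖) *
          ‖(1 - z / w 0) * cexp (((((w 0)⁻¹).re : ℝ) : ℂ) * z)‖) := by ring

/-- In the limit: `|w₀ - z| · |E(z̄)| ≤ |w₀ - z̄| · |E(z)|` for `Im z > 0`. -/
theorem structFn_norm_conj_le {w : ℕ → ℂ} {δ B : ℝ} (hδ : 0 < δ)
    (hw : ∀ k, δ ≤ -(w k).im ∧ -(w k).im ≤ B) (hs : Summable fun k => 1 / (1 + (w k).re ^ 2))
    {z : ℂ} (hz : 0 < z.im) :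
    ‖w 0 - z‖ * ‖∏' k, (1 - conj z / w k) * cexp (((((w k)⁻¹).re : ℝ) : ℂ) * conj z)‖ ≤
      ‖w 0 - conj z‖ * ‖∏' k, (1 - z / w k) * cexp (((((w k)⁻¹).re : ℝ) : ℂ) * z)‖ := by
  have hw' : ∀ k, (w k).im < 0 := fun k => by linarith [(hw k).1]
  have h1 := (((structFn_tendsto_prod hδ hw hs (conj z)).comp
    (tendsto_add_atTop_nat 1)).norm).const_mul (‖w 0 - z‖)
  have h2 := (((structFn_tendsto_prod hδ hw hs z).comp
    (tendsto_add_atTop_nat 1)).norm).const_mul (‖w 0 - conj z‖)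
  exact le_of_tendsto_of_tendsto' h1 h2 fun N => structFn_prod_conj_le hw' hz N

/-- **The canonical product over zeros in `Im w ≤ -δ < 0` is a Hermite–Biehler function.** -/
theorem structFn_isHermiteBiehler {w : ℕ → ℂ} {δ B : ℝ} (hδ : 0 < δ)
    (hw : ∀ k, δ ≤ -(w k).im ∧ -(w k).im ≤ B) (hs : Summable fun k => 1 / (1 + (w k).re ^ 2)) :
    IsHermiteBiehler fun z => ∏' k, (1 - z / w k) * cexp (((((w k)⁻¹).re : ℝ) : ℂ) * z) := by
  refine ⟨structFn_differentiable hδ hw hs, fun z hz => ?_⟩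
  have hEz := structFn_ne_zero hδ hw hs (show -δ < z.im by linarith)
  by_cases h0 : ∏' k, (1 - conj z / w k) * cexp (((((w k)⁻¹).re : ℝ) : ℂ) * conj z) = 0
  · simp only [h0, norm_zero, norm_pos_iff]
    exact hEz
  · have hle := structFn_norm_conj_le hδ hw hs hz
    have hlt : ‖w 0 - conj z‖ < ‖w 0 - z‖ :=
      structFn_norm_sub_conj_lt (by linarith [(hw 0).1]) hz
    have hpos : 0 < ‖∏' k, (1 - conj z / w k) * cexp (((((w k)⁻¹).re : ℝ) : ℂ) * conj z)‖ :=
      norm_pos_iff.2 h0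
    exact lt_of_mul_lt_mul_left ((mul_lt_mul_of_pos_right hlt hpos).trans_le hle) (norm_nonneg _)

/-! ### Growth of the logarithmic derivative near the real axis -/

/-- **Polynomial bound for `E'/E` on `Im z ≥ -δ/2`**:
`‖E'(z)/E(z)‖ ≤ (1 + 2/δ + B)(1 + δ⁻²)(Σ_k 1/(1 + (Re w_k)²)) (1 + |z|)²`. -/
theorem structFn_norm_logDeriv_le {w : ℕ → ℂ} {δ B : ℝ} (hδ : 0 < δ)
    (hw : ∀ k, δ ≤ -(w k).im ∧ -(w k).im ≤ B) (hs : Summable fun k => 1 / (1 + (w k).re ^ 2))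
    {z : ℂ} (hz : -(δ / 2) ≤ z.im) :
    ‖deriv (fun z => ∏' k, (1 - z / w k) * cexp (((((w k)⁻¹).re : ℝ) : ℂ) * z)) z /
        ∏' k, (1 - z / w k) * cexp (((((w k)⁻¹).re : ℝ) : ℂ) * z)‖ ≤
      (1 + 2 / δ + B) * (1 + (δ ^ 2)⁻¹) * (∑' k, 1 / (1 + (w k).re ^ 2)) * (1 + ‖z‖) ^ 2 := by
  have hz' : -δ < z.im := by linarith
  have hB : 0 ≤ B := by linarith [(hw 0).1, (hw 0).2]
  have hc : 0 ≤ 2 / δ := by positivity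
  have hsum := structFn_logDeriv w δ B hδ hw hs z hz'
  -- termwise bound
  have hterm : ∀ k, ‖(z - w k)⁻¹ + ((((w k)⁻¹).re : ℝ) : ℂ)‖ ≤
      ((1 + 2 / δ + B) * (1 + ‖z‖) ^ 2) * ((1 + (δ ^ 2)⁻¹) / (1 + (w k).re ^ 2)) := by
    intro k
    have hzk := structFn_ne_pt (hw k).1 hz'
    have hw0 := structFn_w_ne_zero hδ (hw k).1
    have habs : |(w k).im| ≤ B := by
      rw [abs_of_nonpos (by linarith [(hw k).1])]
      exact (hw k).2
    have hwpos : 0 < ‖w k‖ := norm_pos_iff.2 hw0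
    have hd : δ / 2 ≤ ‖z - w k‖ := by
      have h1 := Complex.abs_im_le_norm (z - w k)
      rw [Complex.sub_im] at h1
      have h2 : δ / 2 ≤ z.im - (w k).im := by linarith [(hw k).1]
      exact h2.trans ((le_abs_self _).trans h1)
    have hdpos : 0 < ‖z - w k‖ := by linarith
    have hwk : ‖w k‖ ≤ (1 + 2 * ‖z‖ / δ) * ‖z - w k‖ := by
      have h1 : ‖w k‖ ≤ ‖z‖ + ‖z - w k‖ := by
        have := norm_sub_le z (z - w k)
        rwa [sub_sub_cancel] at this
      have h2 : ‖z‖ ≤ 2 * ‖z‖ / δ * ‖z - w k‖ := by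
        rw [div_mul_eq_mul_div, le_div_iff₀ hδ]
        nlinarith [norm_nonneg z]
      nlinarith
    have hfrac : ‖z‖ / (‖z - w k‖ * ‖w k‖) ≤ ‖z‖ * (1 + 2 * ‖z‖ / δ) / ‖w k‖ ^ 2 := by
      rw [div_le_div_iff₀ (by positivity) (by positivity)]
      have := mul_le_mul_of_nonneg_left hwk (mul_nonneg (norm_nonneg z) (norm_nonneg (w k)))
      nlinarith [this]
    have hpoly : ‖z‖ * (1 + 2 * ‖z‖ / δ) + B ≤ (1 + 2 / δ + B) * (1 + ‖z‖) ^ 2 := by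
      have e : 2 * ‖z‖ / δ = 2 / δ * ‖z‖ := by ring
      rw [e]
      nlinarith [mul_nonneg hc (norm_nonneg z), mul_nonneg hB (norm_nonneg z),
        mul_nonneg (mul_nonneg hc (norm_nonneg z)) (norm_nonneg z),
        mul_nonneg (mul_nonneg hB (norm_nonneg z)) (norm_nonneg z), norm_nonneg z]
    calc ‖(z - w k)⁻¹ + ((((w k)⁻¹).re : ℝ) : ℂ)‖
        ≤ ‖z‖ / (‖z - w k‖ * ‖w k‖) + B / ‖w k‖ ^ 2 := structFn_norm_logDerivTerm_le hw0 habs hzk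
      _ ≤ ‖z‖ * (1 + 2 * ‖z‖ / δ) / ‖w k‖ ^ 2 + B / ‖w k‖ ^ 2 := add_le_add hfrac le_rfl
      _ = (‖z‖ * (1 + 2 * ‖z‖ / δ) + B) * (1 / ‖w k‖ ^ 2) := by ring
      _ ≤ ((1 + 2 / δ + B) * (1 + ‖z‖) ^ 2) * (1 / ‖w k‖ ^ 2) :=
          mul_le_mul_of_nonneg_right hpoly (by positivity)
      _ ≤ ((1 + 2 / δ + B) * (1 + ‖z‖) ^ 2) * ((1 + (δ ^ 2)⁻¹) / (1 + (w k).re ^ 2)) :=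
          mul_le_mul_of_nonneg_left (structFn_inv_norm_sq_le hδ (hw k).1) (by positivity)
  -- summing the majorant
  have hmaj : HasSum (fun k => ((1 + 2 / δ + B) * (1 + ‖z‖) ^ 2) *
      ((1 + (δ ^ 2)⁻¹) / (1 + (w k).re ^ 2)))
      (((1 + 2 / δ + B) * (1 + ‖z‖) ^ 2) * ((1 + (δ ^ 2)⁻¹) * ∑' k, 1 / (1 + (w k).re ^ 2))) := by
    have h := (hs.hasSum.mul_left (1 + (δ ^ 2)⁻¹)).mul_left ((1 + 2 / δ + B) * (1 + ‖z‖) ^ 2)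
    have e : (fun k => ((1 + 2 / δ + B) * (1 + ‖z‖) ^ 2) * ((1 + (δ ^ 2)⁻¹) / (1 + (w k).re ^ 2))) =
        fun k => ((1 + 2 / δ + B) * (1 + ‖z‖) ^ 2) *
          ((1 + (δ ^ 2)⁻¹) * (1 / (1 + (w k).re ^ 2))) := by
      funext k
      ring
    rw [e]
    exact h
  calc _ ≤ ((1 + 2 / δ + B) * (1 + ‖z‖) ^ 2) * ((1 + (δ ^ 2)⁻¹) * ∑' k, 1 / (1 + (w k).re ^ 2)) :=
        hsum.norm_le_of_bounded hmaj hterm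
    _ = (1 + 2 / δ + B) * (1 + (δ ^ 2)⁻¹) * (∑' k, 1 / (1 + (w k).re ^ 2)) * (1 + ‖z‖) ^ 2 := by
        ring

/-! ### The package -/

/-- **Structure functions exist** (registered sub-goal `structFn_exists`). For zeros `w_k` with
`δ ≤ -Im w_k ≤ B` (`δ > 0`) and `Σ_k 1/(1 + (Re w_k)²) < ∞` there is a Hermite–Biehler function `E`
(the canonical product `∏_k (1 - z/w_k) e^{Re(1/w_k) z}`) without zeros in `Im z > -δ`, whose
logarithmic derivative there is `Σ_k (1/(z - w_k) + Re(1/w_k))` (`HasSum`) and satisfies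
`‖E'(z)/E(z)‖ ≤ (1 + 2/δ + B)(1 + δ⁻²)(Σ_k 1/(1 + (Re w_k)²))(1 + |z|)²` on `Im z ≥ -δ/2`. -/
theorem structFn_exists :
    ∀ (w : ℕ → ℂ) (δ B : ℝ), 0 < δ → (∀ k, δ ≤ -(w k).im ∧ -(w k).im ≤ B) →
      Summable (fun k => 1 / (1 + (w k).re ^ 2)) →
      ∃ E : ℂ → ℂ, IsHermiteBiehler E ∧ (∀ z : ℂ, -δ < z.im → E z ≠ 0) ∧
        (∀ z : ℂ, -δ < z.im →
          HasSum (fun k => (z - w k)⁻¹ + ((((w k)⁻¹).re : ℝ) : ℂ)) (deriv E z / E z)) ∧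
        (∀ z : ℂ, -(δ / 2) ≤ z.im → ‖deriv E z / E z‖ ≤
          (1 + 2 / δ + B) * (1 + (δ ^ 2)⁻¹) * (∑' k, 1 / (1 + (w k).re ^ 2)) * (1 + ‖z‖) ^ 2) :=
  fun w δ B hδ hw hs =>
    ⟨fun z => ∏' k, (1 - z / w k) * cexp (((((w k)⁻¹).re : ℝ) : ℂ) * z),
      structFn_isHermiteBiehler hδ hw hs, fun _ hz => structFn_ne_zero hδ hw hs hz,
      fun z hz => structFn_logDeriv w δ B hδ hw hs z hz,
      fun _ hz => structFn_norm_logDeriv_le hδ hw hs hz⟩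

end Summit.RiemannHypothesis.RiemannHypothesis.Theorems.SpectralTraceWindowTraceArch

end
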